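/-
Origin: expansion seat `planner-pub-hodgecm-pv07-g2-0`, handover #10 2026-08-18T07:07:51Z (`HOME/pub-hodgecm-pv07-g2/lean/Pv07g2/DilationIntertwiner.lean`, md5 b399c7bf, 116 lines);
landed by the gen-7 packager in gate run 25 as `HodgeCM/PerL34/LocalFactors/DilationIntertwiner.lean` (import ^import Pv07g2\.DilationModel\b→import HodgeCM.PerL34.LocalFactors.DilationModel ×1).
-/
/-
Origin: pub-hodgecm-pv07-g2 (DAG-NODE PROVER #07, gen 2), 2026-08-18.
Slot:   HodgeCM/PerL34/LocalFactors/DilationIntertwiner.lean   (module rename `Pv07g2.DilationIntertwiner` →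
        `HodgeCM.PerL34.LocalFactors.DilationIntertwiner`; import `Pv07g2.DilationModel` ↦ the LANDED
        `HodgeCM.PerL34.LocalFactors.DilationModel`).
-/
import Summits.HodgeConjecture.HodgeCM.PerL34.LocalFactors.DilationModel_2

/-!
# D4 (b) in its PRINT form implies the kernel hypothesis `hcoeff`

The residual D4 (b) of the `pv07` lineage (PerL v5, proof of Lemma 4.2(b), l. 617; `GAPS.md` pv07-G1,
pv07g2-K4 (i), K6) is the sentence *"ω_v restricted to `U(W_i)(L_{0,v}) ≅ L_{0,v}^×` acts on `S(L_{0,v}³)` by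
`φ ↦ (y ↦ ν(y)|y|^{3/2} φ(yx))` up to a unitary character"* — in print ([MVW] LNM 1291 ch. 3 §III.1; Kudla 1996
notes III Rem. 6.3): the restriction of the Weil representation to a type II pair is (a unitary twist of) the natural
geometric representation, i.e. there is an ISOMETRIC INTERTWINER onto the dilation model.  The kernel consumes D4 (b)
through the matrix-coefficient hypothesis `hcoeff` of `DilationModel.hasSplitModel_of_coeff` (landed, run 24) /
`coeff_eq` of `SplitPlaceDilation.splitPlaceModelOfDilation` (pv13-g3).  THIS FILE records, in the kernel, that the
print form implies the consumed form — so that `hcoeff` is visibly nothing but D4 (b) read on the chosen vector: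

* `coeff_eq_of_intertwiner` — an isometry `U : L.Sp →ₗᵢ[ℂ] L²(Fⁿ, μV)` with `U (ω(y) φ) = T_{t y} (U φ)` along the
  orbit of `φ` and `U φ = 1_D` gives `⟪φ, ω(y)φ⟫ = ⟪1_D, T_{t y} 1_D⟫` (`LinearIsometry.inner_map_map`);
* `coeff_eq_of_factor_intertwiner` — the same through a PURE-TENSOR factorisation
  `⟪φ, ω(y)φ⟫ = c · ⟪φ_v, ω_v(y)φ_v⟫_v` (`c = ∏_{w ≠ v} ‖φ_w‖²`, the shape of N31h's canonical pieces) and a local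
  intertwiner `U_v : H_v →ₗᵢ[ℂ] L²(Fⁿ)` of `ω_v` with the dilation model along `φ_v ↦ 1_D`;
* `hasSplitModel_of_intertwiner`, `hasSplitModel_of_factor_intertwiner` — hence `HasSplitModel L`
  (= `hasSplitModel_of_coeff` with `hcoeff` DISCHARGED by the intertwiner), so `0 < I_v` by the landed
  `loc_I_pos_of_hasSplitModel`.

Nothing is cited or posited; the intertwiner is a HYPOTHESIS (it is D4 (b) itself, typed).
-/

noncomputable section

open MeasureTheory MeasureTheory.Measure Set Metric Complex ComplexConjugate
open scoped ENNReal NNReal Pointwise InnerProductSpace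

namespace HodgeCM
namespace PerL34
namespace LocalFactors
namespace DilationModel

variable {F : Type} [NormedField F] [IsUltrametricDist F] [ProperSpace F] {n : ℕ}
variable [MeasurableSpace (Fin n → F)] [BorelSpace (Fin n → F)] (μV : Measure (Fin n → F)) [μV.IsAddHaarMeasure]
variable (x₀ : Fin n → F) (r : ℝ) (ν χ' : Fˣ →* Circle)

/-- **D4 (b), print form ⇒ consumed form.**  An isometric intertwiner of `(L.Sp, ω)` with the dilation model
along the orbit of `φ`, carrying `φ` to `1_D`, gives the matrix-coefficient identity `hcoeff` (with `c = 1`). -/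
theorem coeff_eq_of_intertwiner (L : EulerFactorisation.LocalIntegrand) (t : L.G → Fˣ)
    (U : L.Sp →ₗᵢ[ℂ] Lp ℂ 2 μV) (hU : ∀ y, U (L.ω y L.φ) = dilationRep μV ν (t y) (U L.φ))
    (hφ : U L.φ = ballIndicator μV x₀ r) (y : L.G) :
    ⟪L.φ, L.ω y L.φ⟫_ℂ = ⟪ballIndicator μV x₀ r, dilationRep μV ν (t y) (ballIndicator μV x₀ r)⟫_ℂ := by
  rw [← U.inner_map_map, hU, hφ]

/-- the same through a pure-tensor factorisation of the coefficient and a LOCAL intertwiner `U_v`. -/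
theorem coeff_eq_of_factor_intertwiner (L : EulerFactorisation.LocalIntegrand) (t : L.G → Fˣ)
    {Hv : Type*} [NormedAddCommGroup Hv] [InnerProductSpace ℂ Hv] (ωv : L.G → Hv → Hv) (φv : Hv) (c : ℝ)
    (hfac : ∀ y, ⟪L.φ, L.ω y L.φ⟫_ℂ = (c : ℂ) * ⟪φv, ωv y φv⟫_ℂ)
    (U : Hv →ₗᵢ[ℂ] Lp ℂ 2 μV) (hU : ∀ y, U (ωv y φv) = dilationRep μV ν (t y) (U φv))
    (hφ : U φv = ballIndicator μV x₀ r) (y : L.G) :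
    ⟪L.φ, L.ω y L.φ⟫_ℂ
      = (c : ℂ) * ⟪ballIndicator μV x₀ r, dilationRep μV ν (t y) (ballIndicator μV x₀ r)⟫_ℂ := by
  rw [hfac, ← U.inner_map_map, hU, hφ]

/-- **`HasSplitModel` from D4 (b) in print form** (intertwiner along `φ ↦ 1_D`), the characters trivial on `U₁`
and the coordinate `t` measurable with `0 < μ(t⁻¹ U₁) < ∞` — `hasSplitModel_of_coeff` with `hcoeff` discharged. -/
theorem hasSplitModel_of_intertwiner (L : EulerFactorisation.LocalIntegrand) (t : L.G → Fˣ)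
    (hr : r < ‖x₀‖) (hr0 : 0 < r)
    (hν : ∀ y : Fˣ, (y : F) ∈ U1 x₀ r → ν y = 1) (hχ : ∀ y : Fˣ, (y : F) ∈ U1 x₀ r → χ' y = 1)
    (U : L.Sp →ₗᵢ[ℂ] Lp ℂ 2 μV) (hU : ∀ y, U (L.ω y L.φ) = dilationRep μV ν (t y) (U L.φ))
    (hφ : U L.φ = ballIndicator μV x₀ r)
    (hchar : ∀ y, L.χ y = (χ' (t y) : ℂ))
    (hmeas : MeasurableSet (t ⁻¹' ((Units.val : Fˣ → F) ⁻¹' U1 x₀ r)))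
    (hpos : L.μ (t ⁻¹' ((Units.val : Fˣ → F) ⁻¹' U1 x₀ r)) ≠ 0)
    (hfin : L.μ (t ⁻¹' ((Units.val : Fˣ → F) ⁻¹' U1 x₀ r)) ≠ ⊤) :
    HasSplitModel L :=
  hasSplitModel_of_coeff μV x₀ r ν χ' L t 1 one_pos hr hr0 hν hχ
    (fun y => by rw [Complex.ofReal_one, one_mul]; exact coeff_eq_of_intertwiner μV x₀ r ν L t U hU hφ y)
    hchar hmeas hpos hfin

/-- the pure-tensor version: factorisation constant `c > 0` and a local intertwiner. -/
theorem hasSplitModel_of_factor_intertwiner (L : EulerFactorisation.LocalIntegrand) (t : L.G → Fˣ)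
    (hr : r < ‖x₀‖) (hr0 : 0 < r)
    (hν : ∀ y : Fˣ, (y : F) ∈ U1 x₀ r → ν y = 1) (hχ : ∀ y : Fˣ, (y : F) ∈ U1 x₀ r → χ' y = 1)
    {Hv : Type*} [NormedAddCommGroup Hv] [InnerProductSpace ℂ Hv] (ωv : L.G → Hv → Hv) (φv : Hv)
    (c : ℝ) (hc : 0 < c) (hfac : ∀ y, ⟪L.φ, L.ω y L.φ⟫_ℂ = (c : ℂ) * ⟪φv, ωv y φv⟫_ℂ)
    (U : Hv →ₗᵢ[ℂ] Lp ℂ 2 μV) (hU : ∀ y, U (ωv y φv) = dilationRep μV ν (t y) (U φv))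
    (hφ : U φv = ballIndicator μV x₀ r)
    (hchar : ∀ y, L.χ y = (χ' (t y) : ℂ))
    (hmeas : MeasurableSet (t ⁻¹' ((Units.val : Fˣ → F) ⁻¹' U1 x₀ r)))
    (hpos : L.μ (t ⁻¹' ((Units.val : Fˣ → F) ⁻¹' U1 x₀ r)) ≠ 0)
    (hfin : L.μ (t ⁻¹' ((Units.val : Fˣ → F) ⁻¹' U1 x₀ r)) ≠ ⊤) :
    HasSplitModel L :=
  hasSplitModel_of_coeff μV x₀ r ν χ' L t c hc hr hr0 hν hχ
    (coeff_eq_of_factor_intertwiner μV x₀ r ν L t ωv φv c hfac U hU hφ) hchar hmeas hpos hfin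

/-- hence `0 < I_v(φ_v)` from D4 (b) in print form (landed `loc_I_pos_of_hasSplitModel`). -/
theorem I_pos_of_intertwiner (L : EulerFactorisation.LocalIntegrand) (t : L.G → Fˣ)
    (hr : r < ‖x₀‖) (hr0 : 0 < r)
    (hν : ∀ y : Fˣ, (y : F) ∈ U1 x₀ r → ν y = 1) (hχ : ∀ y : Fˣ, (y : F) ∈ U1 x₀ r → χ' y = 1)
    (U : L.Sp →ₗᵢ[ℂ] Lp ℂ 2 μV) (hU : ∀ y, U (L.ω y L.φ) = dilationRep μV ν (t y) (U L.φ))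
    (hφ : U L.φ = ballIndicator μV x₀ r)
    (hchar : ∀ y, L.χ y = (χ' (t y) : ℂ))
    (hmeas : MeasurableSet (t ⁻¹' ((Units.val : Fˣ → F) ⁻¹' U1 x₀ r)))
    (hpos : L.μ (t ⁻¹' ((Units.val : Fˣ → F) ⁻¹' U1 x₀ r)) ≠ 0)
    (hfin : L.μ (t ⁻¹' ((Units.val : Fˣ → F) ⁻¹' U1 x₀ r)) ≠ ⊤) :
    0 < L.I :=
  loc_I_pos_of_hasSplitModel L
    (hasSplitModel_of_intertwiner μV x₀ r ν χ' L t hr hr0 hν hχ U hU hφ hchar hmeas hpos hfin)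

end DilationModel
end LocalFactors
end PerL34
end HodgeCM

end
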